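import Literature.AlgebraicGeometry.Modules.PullbackAffineChart
import Literature.AlgebraicGeometry.Modules.DualSectionsEquiv
import Literature.AlgebraicGeometry.KTheory.PullbackVectorBundle
import HarnessLib

/-!
# Trivialisations `E ≅ 𝒪_X` read on sections: generators, units, and the transport of pulled-back sections
# along `pullbackComp` / `pullbackCongr` (elementwise pseudofunctor bookkeeping)

Layer `Literature/AlgebraicGeometry/Modules`, namespace `Literature.AlgebraicGeometry.Modules`.  THEOREMS ONLY (no
definition, no named fact, no instance, no notation, no `sorry`).  Generic bookkeeping for the fpqc descent of
trivialisations of line bundles (cell `hodgecm-mathlib`, HECKE-LINK D6 brick (u6b); nothing here is about HC).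

* §1 For a trivialisation `γ : E ≅ 𝒪_X`: every section is `γ(t) · γ⁻¹(1)` (`eq_smul_inv_app_one`); two trivialisations
  `β₁, β₂` have `β₁(β₂⁻¹ 1) · β₂(β₁⁻¹ 1) = 1` (`hom_app_inv_app_one_mul`), so `β₁(β₂⁻¹ 1)` is a unit; `r ↦ r · γ⁻¹(1)` is
  injective (`smul_inv_app_one_injective`).  [Hartshorne1977] II §5 (`Hom_{𝒪_X}(𝒪_X, E) = Γ(X, E)`).
* §2 `𝒪`-pull-backs: Mathlib's `SheafOfModules.pullbackObjUnitToUnit p : p^*𝒪_Y ⟶ 𝒪_X` is an isomorphism (`Opens.map`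
  is final, ★ `KTheory.final_opensMap`) sending `η_p(y)` to `p♯ y` (`pullbackObjUnitToUnit_app_unitSection'`), and its
  inverse sends `1` to `η_p(1)`; a section `e` of `π` gives `e♯(π♯ a) = a` on global functions (`app_app_of_comp_eq_id`).
* §3 Elementwise transport: `pullbackComp` is associative on sections (`pullbackComp_assoc_hom_app`, from Mathlib
  `SheafOfModules.pullback_assoc`), and `pullbackCongr` (an `eqToIso`) transports pulled-back sections and `pullbackComp`
  along equalities of morphisms (`pullbackCongr_*`, all by `subst`).  [StacksProject, Tag 0097] (Sheaves §6.26); EGA 0_I (4.4.3).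

## References
* [Hartshorne1977] R. Hartshorne, *Algebraic Geometry*, GTM 52 (1977), II §5 (pp. 109–110).
* [StacksProject] The Stacks Project, Tag 0094 / 0095 / 0097 (Sheaves §6.26: `f^*`, `f_*`, `(g ∘ f)^* ≅ f^* ∘ g^*`), Tag 01AK.
* [GortzWedhorn2020] U. Görtz, T. Wedhorn, *Algebraic Geometry I*, 2nd ed. (2020), (7.8) (inverse image of modules).
-/

noncomputable section

-- `TopCat.Presheaf`/`Scheme.Modules` are not reducible (as in Mathlib's `AlgebraicGeometry/Modules`).
set_option backward.isDefEq.respectTransparency false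

universe u

open CategoryTheory CategoryTheory.Limits AlgebraicGeometry TopologicalSpace Opposite

namespace Literature.AlgebraicGeometry.Modules

/-! ## §1 Trivialisations read on sections -/

section Trivialisations

variable {X : Scheme.{u}} {E F : X.Modules}

/-- The components of an isomorphism of modules are injective. [cite: Hartshorne1977, II §5 (p. 109)] -/
theorem app_injective_of_iso (γ : E ≅ F) (U : X.Opens) : Function.Injective (γ.hom.app U) := by
  intro x y hxy
  have hx : γ.inv.app U (γ.hom.app U x) = x := by
    rw [← CategoryTheory.comp_apply, ← Scheme.Modules.Hom.comp_app, Iso.hom_inv_id, Scheme.Modules.Hom.id_app]; rfl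
  have hy : γ.inv.app U (γ.hom.app U y) = y := by
    rw [← CategoryTheory.comp_apply, ← Scheme.Modules.Hom.comp_app, Iso.hom_inv_id, Scheme.Modules.Hom.id_app]; rfl
  rw [← hx, ← hy, hxy]

variable (γ : E ≅ SheafOfModules.unit X.ringCatSheaf) (U : X.Opens)

/-- In `Γ(𝒪_X, U)` the module action of `Γ(X, U)` is multiplication. [cite: Hartshorne1977, II §5 (p. 109)] -/
theorem smul_unit_eq_mul (r : Γ(X, U)) (y : Γ(SheafOfModules.unit X.ringCatSheaf, U)) :
    r • y = @HMul.hMul Γ(X, U) Γ(X, U) Γ(X, U) instHMul r (show Γ(X, U) from y) := rfl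

/-- **Every section is a multiple of the generator**: for a trivialisation `γ : E ≅ 𝒪_X` and `t ∈ Γ(E, U)`,
`t = γ(t) · γ⁻¹(1)`. [cite: Hartshorne1977, II §5 (pp. 109–110)] -/
theorem eq_smul_inv_app_one (t : Γ(E, U)) :
    t = (show Γ(X, U) from γ.hom.app U t) • γ.inv.app U (1 : Γ(X, U)) := by
  apply app_injective_of_iso γ U
  rw [Scheme.Modules.Hom.app_smul, hom_app_inv_app, smul_unit_eq_mul]
  exact (@mul_one Γ(X, U) _ _).symm

/-- **Two trivialisations differ by a unit**: `β₁(β₂⁻¹ 1) · β₂(β₁⁻¹ 1) = 1` in `Γ(X, U)`.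
[cite: Hartshorne1977, II §5 (pp. 109–110)] -/
theorem hom_app_inv_app_one_mul (β₁ β₂ : E ≅ SheafOfModules.unit X.ringCatSheaf) :
    @HMul.hMul Γ(X, U) Γ(X, U) Γ(X, U) instHMul
        (show Γ(X, U) from β₁.hom.app U (β₂.inv.app U (1 : Γ(X, U))))
        (show Γ(X, U) from β₂.hom.app U (β₁.inv.app U (1 : Γ(X, U)))) = 1 := by
  have h := eq_smul_inv_app_one β₁ U (β₂.inv.app U (1 : Γ(X, U)))
  have h' := congrArg (β₂.hom.app U) h
  rw [hom_app_inv_app, Scheme.Modules.Hom.app_smul, smul_unit_eq_mul] at h'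
  exact h'.symm

/-- `β₁(β₂⁻¹ 1)` is a unit of `Γ(X, U)`. [cite: Hartshorne1977, II §5 (pp. 109–110)] -/
theorem isUnit_hom_app_inv_app_one (β₁ β₂ : E ≅ SheafOfModules.unit X.ringCatSheaf) :
    IsUnit (show Γ(X, U) from β₁.hom.app U (β₂.inv.app U (1 : Γ(X, U)))) :=
  IsUnit.of_mul_eq_one _ (hom_app_inv_app_one_mul U β₁ β₂)

/-- **Every section is a multiple of the generator, second form**: `β₂(t) = β₂(β₁⁻¹ 1) · β₁(t)`.
[cite: Hartshorne1977, II §5 (pp. 109–110)] -/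
theorem hom_app_eq_mul_hom_app (β₁ β₂ : E ≅ SheafOfModules.unit X.ringCatSheaf) (t : Γ(E, U)) :
    (show Γ(X, U) from β₂.hom.app U t) =
      @HMul.hMul Γ(X, U) Γ(X, U) Γ(X, U) instHMul
        (show Γ(X, U) from β₂.hom.app U (β₁.inv.app U (1 : Γ(X, U)))) (show Γ(X, U) from β₁.hom.app U t) := by
  have h := eq_smul_inv_app_one β₁ U t
  have h' := congrArg (β₂.hom.app U) h
  rw [Scheme.Modules.Hom.app_smul, smul_unit_eq_mul] at h'
  exact h'.trans (@mul_comm Γ(X, U) _ _ _)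

/-- **The generator is torsion-free**: `r ↦ r · γ⁻¹(1)` is injective on `Γ(X, U)`.
[cite: Hartshorne1977, II §5 (pp. 109–110)] -/
theorem smul_inv_app_one_injective :
    Function.Injective fun r : Γ(X, U) => r • γ.inv.app U (1 : Γ(X, U)) := by
  intro r r' h
  have h' := congrArg (γ.hom.app U) h
  simp only [Scheme.Modules.Hom.app_smul, hom_app_inv_app, smul_unit_eq_mul] at h'
  have e1 : @HMul.hMul Γ(X, U) Γ(X, U) Γ(X, U) instHMul r 1 = r := mul_one r
  have e2 : @HMul.hMul Γ(X, U) Γ(X, U) Γ(X, U) instHMul r' 1 = r' := mul_one r'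
  rw [e1, e2] at h'
  exact h'

end Trivialisations

/-! ## §2 A section of a morphism on global functions -/

section SectionOfMorphism

variable {T X : Scheme.{u}} (e : T ⟶ X) (π : X ⟶ T)

/-- **`e♯(π♯ a) = a`** on global functions for a section `e` of `π` (`e ≫ π = 𝟙`). [cite: GortzWedhorn2020, (7.8)] -/
theorem app_app_top_of_comp_eq_id (h : e ≫ π = 𝟙 T) (a : Γ(T, ⊤)) :
    e.app (π ⁻¹ᵁ ⊤) (π.app ⊤ a) = a := by
  have h1 : e.app (π ⁻¹ᵁ ⊤) (π.app ⊤ a) = (e ≫ π).app ⊤ a := by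
    rw [Scheme.Hom.comp_app]; rfl
  rw [h1, Scheme.Hom.congr_app h ⊤, Scheme.Hom.id_app]
  change T.presheaf.map (eqToHom _).op a = a
  have h2 : ∀ (q : (⊤ : T.Opens) = ⊤), T.presheaf.map (eqToHom q).op a = a := fun q => by
    rw [eqToHom_refl, op_id, CategoryTheory.Functor.map_id]; rfl
  exact h2 _

end SectionOfMorphism

/-! ## §3 Elementwise transport along `pullbackComp` and `pullbackCongr` -/

section Transport

variable {X₁ X₂ X₃ X₄ : Scheme.{u}}

/-- **Associativity of `pullbackComp`** (Mathlib `SheafOfModules.pullback_assoc`, component form): the two ways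
`f^* g^* h^* M ⟶ (f ≫ g ≫ h)^* M` agree. [cite: StacksProject, Tag 0097] -/
theorem pullbackComp_assoc_hom_app (f : X₁ ⟶ X₂) (g : X₂ ⟶ X₃) (h : X₃ ⟶ X₄) (M : X₄.Modules) :
    (Scheme.Modules.pullbackComp f g).hom.app ((Scheme.Modules.pullback h).obj M) ≫
        (Scheme.Modules.pullbackComp (f ≫ g) h).hom.app M =
      (Scheme.Modules.pullback f).map ((Scheme.Modules.pullbackComp g h).hom.app M) ≫
        (Scheme.Modules.pullbackComp f (g ≫ h)).hom.app M := by
  let e₁ := Scheme.Modules.pullbackComp f (g ≫ h)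
  let e₂ := Functor.isoWhiskerRight (Scheme.Modules.pullbackComp g h) (Scheme.Modules.pullback f)
  let e₃ := Functor.isoWhiskerLeft (Scheme.Modules.pullback h) (Scheme.Modules.pullbackComp f g)
  let e₄ := Scheme.Modules.pullbackComp (f ≫ g) h
  have H : e₃.hom ≫ e₄.hom = (Functor.associator _ _ _).inv ≫ e₂.hom ≫ e₁.hom :=
    congr_arg Iso.hom
      (SheafOfModules.pullback_assoc.{u} h.toRingCatSheafHom g.toRingCatSheafHom f.toRingCatSheafHom)
  have H' := NatTrans.congr_app H M
  simp only [NatTrans.comp_app, Functor.isoWhiskerLeft_hom, Functor.isoWhiskerRight_hom, Functor.whiskerLeft_app,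
    Functor.whiskerRight_app, Functor.associator_inv_app, Category.id_comp, e₁, e₂, e₃, e₄] at H'
  exact H'

/-- Associativity of `pullbackComp` on sections. [cite: StacksProject, Tag 0097] -/
theorem pullbackComp_assoc_hom_app_apply (f : X₁ ⟶ X₂) (g : X₂ ⟶ X₃) (h : X₃ ⟶ X₄) (M : X₄.Modules)
    (U : X₁.Opens)
    (x : Γ((Scheme.Modules.pullback f).obj ((Scheme.Modules.pullback g).obj ((Scheme.Modules.pullback h).obj M)), U)) :
    ((Scheme.Modules.pullbackComp (f ≫ g) h).hom.app M).app U
        (((Scheme.Modules.pullbackComp f g).hom.app ((Scheme.Modules.pullback h).obj M)).app U x) =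
      ((Scheme.Modules.pullbackComp f (g ≫ h)).hom.app M).app U
        (((Scheme.Modules.pullback f).map ((Scheme.Modules.pullbackComp g h).hom.app M)).app U x) := by
  change (((Scheme.Modules.pullbackComp f g).hom.app ((Scheme.Modules.pullback h).obj M)) ≫
      (Scheme.Modules.pullbackComp (f ≫ g) h).hom.app M).app U x =
    (((Scheme.Modules.pullback f).map ((Scheme.Modules.pullbackComp g h).hom.app M)) ≫
      (Scheme.Modules.pullbackComp f (g ≫ h)).hom.app M).app U x
  rw [pullbackComp_assoc_hom_app]
  rfl

variable {Y Z : Scheme.{u}}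

/-- `pullbackCongr` along `q = q` is the identity on sections. [cite: StacksProject, Tag 0097] -/
theorem pullbackCongr_hom_app_app_self {q : Y ⟶ Z} (hq : q = q) (N : Z.Modules) (U : Y.Opens)
    (x : Γ((Scheme.Modules.pullback q).obj N, U)) :
    ((Scheme.Modules.pullbackCongr hq).hom.app N).app U x = x := rfl

/-- `pullbackCongr`'s inverse is `pullbackCongr` of the symmetric equation. [cite: StacksProject, Tag 0097] -/
theorem pullbackCongr_inv_eq {q q' : Y ⟶ Z} (hq : q = q') :
    (Scheme.Modules.pullbackCongr hq).inv = (Scheme.Modules.pullbackCongr hq.symm).hom := by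
  subst hq; rfl

/-- Transports along `pullbackCongr` compose. [cite: StacksProject, Tag 0097] -/
theorem pullbackCongr_hom_app_app_trans {q q' q'' : Y ⟶ Z} (hq : q = q') (hq' : q' = q'') (N : Z.Modules)
    (U : Y.Opens) (x : Γ((Scheme.Modules.pullback q).obj N, U)) :
    ((Scheme.Modules.pullbackCongr hq').hom.app N).app U (((Scheme.Modules.pullbackCongr hq).hom.app N).app U x) =
      ((Scheme.Modules.pullbackCongr (hq.trans hq')).hom.app N).app U x := by
  subst hq; subst hq'; rfl

/-- Transport along `pullbackCongr` is injective. [cite: StacksProject, Tag 0097] -/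
theorem pullbackCongr_hom_app_app_injective {q q' : Y ⟶ Z} (hq : q = q') (N : Z.Modules) (U : Y.Opens) :
    Function.Injective (((Scheme.Modules.pullbackCongr hq).hom.app N).app U) := by
  subst hq; exact fun x y h => h

/-- Transport along `pullbackCongr` commutes with morphisms of modules (naturality of an `eqToIso`).
[cite: StacksProject, Tag 0097] -/
theorem pullbackCongr_hom_app_app_map {q q' : Y ⟶ Z} (hq : q = q') {N N' : Z.Modules} (φ : N ⟶ N') (U : Y.Opens)
    (x : Γ((Scheme.Modules.pullback q).obj N, U)) :
    ((Scheme.Modules.pullbackCongr hq).hom.app N').app U (((Scheme.Modules.pullback q).map φ).app U x) =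
      ((Scheme.Modules.pullback q').map φ).app U (((Scheme.Modules.pullbackCongr hq).hom.app N).app U x) := by
  subst hq; rfl

/-- **Pulled-back sections along equal morphisms** (global sections, every component read at `⊤` — the opens
`q⁻¹⊤` ARE `⊤`): `η_q(x)` transports to `η_{q'}(x)`. [cite: StacksProject, Tag 0097] -/
theorem pullbackCongr_hom_app_app_unitSection_top {q q' : Y ⟶ Z} (hq : q = q') (N : Z.Modules) (x : Γ(N, ⊤)) :
    ((Scheme.Modules.pullbackCongr hq).hom.app N).app ⊤ (unitSection q N ⊤ x) = unitSection q' N ⊤ x := by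
  subst hq; rfl

/-- **`pullbackComp` along equal first morphisms** (global sections, components at `⊤`): for `u = u'`, the
`(u ≫ g)^*`-reading of `η_u(x)` transports to the `(u' ≫ g)^*`-reading of `η_{u'}(x)`. [cite: StacksProject, Tag 0097] -/
theorem pullbackComp_hom_app_unitSection_congr_left {T' : Scheme.{u}} {u u' : T' ⟶ Y} (hu : u = u') (g : Y ⟶ Z)
    (N : Z.Modules) (x : Γ((Scheme.Modules.pullback g).obj N, ⊤)) :
    ((Scheme.Modules.pullbackCongr (show u ≫ g = u' ≫ g by rw [hu])).hom.app N).app ⊤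
        (((Scheme.Modules.pullbackComp u g).hom.app N).app ⊤
          (unitSection u ((Scheme.Modules.pullback g).obj N) ⊤ x)) =
      ((Scheme.Modules.pullbackComp u' g).hom.app N).app ⊤
        (unitSection u' ((Scheme.Modules.pullback g).obj N) ⊤ x) := by
  subst hu; rfl

/-- **`pullbackComp` along equal second morphisms** (global sections, components at `⊤`): for `v = v'` and
`x ∈ Γ(v^*N, ⊤)`, the `(w ≫ v)^*`-reading of `η_w(x)` transports to the `(w ≫ v')^*`-reading of `η_w` of the transported
section. [cite: StacksProject, Tag 0097] -/
theorem pullbackComp_hom_app_unitSection_congr_right {T' : Scheme.{u}} (w : T' ⟶ Y) {v v' : Y ⟶ Z} (hv : v = v')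
    (N : Z.Modules) (x : Γ((Scheme.Modules.pullback v).obj N, ⊤)) :
    ((Scheme.Modules.pullbackCongr (show w ≫ v = w ≫ v' by rw [hv])).hom.app N).app ⊤
        (((Scheme.Modules.pullbackComp w v).hom.app N).app ⊤
          (unitSection w ((Scheme.Modules.pullback v).obj N) ⊤ x)) =
      ((Scheme.Modules.pullbackComp w v').hom.app N).app ⊤
        (unitSection w ((Scheme.Modules.pullback v').obj N) ⊤
          (((Scheme.Modules.pullbackCongr hv).hom.app N).app ⊤ x)) := by
  subst hv; rfl

/-- ★ `pullbackComp_hom_app_unitSection` for GLOBAL sections with every component read at `⊤`: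
`C_{g,f}(η_g(η_f(m))) = η_{g ≫ f}(m)`. [cite: StacksProject, Tag 0097] -/
theorem pullbackComp_hom_app_top_unitSection_top {X' : Scheme.{u}} (g : X' ⟶ Y) (f : Y ⟶ Z) (M : Z.Modules)
    (m : Γ(M, ⊤)) :
    ((Scheme.Modules.pullbackComp g f).hom.app M).app ⊤
        (unitSection g ((Scheme.Modules.pullback f).obj M) ⊤ (unitSection f M ⊤ m)) =
      unitSection (g ≫ f) M ⊤ m :=
  pullbackComp_hom_app_unitSection f M g ⊤ m

/-- ★ `pullback_map_app_unitSection` for GLOBAL sections with the component read at `⊤`: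
`(g^*φ)(η_g(y)) = η_g(φ(y))`. [cite: StacksProject, Tag 0097] -/
theorem pullback_map_app_top_unitSection_top {X' : Scheme.{u}} (g : X' ⟶ Y) {A B : Y.Modules} (φ : A ⟶ B)
    (y : Γ(A, ⊤)) :
    ((Scheme.Modules.pullback g).map φ).app ⊤ (unitSection g A ⊤ y) = unitSection g B ⊤ (φ.app ⊤ y) :=
  pullback_map_app_unitSection g φ ⊤ y

/-- **`pullbackComp` and `pullbackCongr` in the second variable, morphism form**: for `v = v'`,
`w^*(pullbackCongr) ≫ pullbackComp w v' = pullbackComp w v ≫ pullbackCongr`. [cite: StacksProject, Tag 0097] -/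
theorem pullback_map_pullbackCongr_comp_pullbackComp {T' : Scheme.{u}} (w : T' ⟶ Y) {v v' : Y ⟶ Z} (hv : v = v')
    (N : Z.Modules) :
    (Scheme.Modules.pullback w).map ((Scheme.Modules.pullbackCongr hv).hom.app N) ≫
        (Scheme.Modules.pullbackComp w v').hom.app N =
      (Scheme.Modules.pullbackComp w v).hom.app N ≫
        (Scheme.Modules.pullbackCongr (show w ≫ v = w ≫ v' by rw [hv])).hom.app N := by
  subst hv
  simp [Scheme.Modules.pullbackCongr]

end Transport

end Literature.AlgebraicGeometry.Modules

end
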